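import Summits.MatrixMultiplication.MatrixMultiplication.Theses.MarginalColumns
import Summits.MatrixMultiplication.MatrixMultiplication.Theorems.SecondColumnDominates.Negative.LoadBearing
import Summits.MatrixMultiplication.MatrixMultiplication.Theorems.SecondColumnCheap.Negative.LoadBearing
import Literature.Computability.AlgebraicComplexity.BorderRankMatMulSmallProofs
import Literature.Computability.AlgebraicComplexity.BorderRankMatMulTwoSeven

/-!
# Kill surface of the target `MarginalColumns.Thesis` (stmt-MatrixMultiplication-16308)

Refuter target-vetting of route `MarginalColumns` (2026-08-17). The target is, by `Iff.rfl`, the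
conjunction `SecondColumnDominates ∧ SecondColumnCheap` (D ∧ C) of the route's two cruxes, each vetted
separately (`Theorems/SecondColumnDominates/Negative/LoadBearing.lean`,
`Theorems/SecondColumnCheap/Negative/LoadBearing.lean`). Write `T n w := algBorderRank (matMulTensor ℂ n n w)`
(`= R̲⟨n,n,w⟩`, an `n × n` matrix times an `n × w` matrix, Bläser's border rank over `ℂ[ε]`).
This file records, sorry-free and over PROVED tree facts only, what kills the target:

* `tower_le_of_dominates` — D's subtraction-free tower bound
  `T n w + (w−1)·T n 1 ≤ T n 1 + (w−1)·T n 2` for ALL `w ≥ 1` (D quantifies over every `w`, not only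
  `w ≤ n`, so the bound — and the kill surface — extends to the whole tower).
* `thesis_false_of_twenty_le_cube` — the first open cell: `20 ≤ R̲⟨3,3,3⟩` refutes the target
  (D at `(n,w) = (3,2)` with Smirnov's `R̲⟨3,3,2⟩ ≤ 14`, proved in tree, and flattening `9 ≤ R̲⟨3,3,1⟩`;
  printed window `[17, 20]`).
* `thesis_false_of_towerTwoTwo_excess` — the sibling tower: any `w ≥ 1` with `3w + 2 ≤ R̲⟨2,2,w⟩`
  refutes the target (D at `n = 2` with Strassen's `R̲⟨2,2,2⟩ ≤ 7` pins `R̲⟨2,2,w⟩ ≤ 3w + 1` for every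
  `w`; print: `3w ≤ R̲ ≤ 3w + ⌈w/7⌉`, Landsberg–Ryder 2017 §3, so the first undecided cell is `w = 8`).
* `thesis_false_of_towerThree_excess` — the `n = 3` tower: any `w ≥ 1` with `5w + 5 ≤ R̲⟨3,3,w⟩`
  refutes the target (`R̲⟨3,3,w⟩ ≤ 5w + 4` for every `w`; Koszul slope is exactly `5w`).
* `envelope_of_thesis`, `thesis_false_of_superlinear_excess` — the conjunction's own content: D ∧ C
  give `R̲⟨n,n,w⟩ ≤ n² + C_ε·(w−1)·n^{1+ε}` for all `n, w ≥ 1`; any family of formats beating this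
  envelope for one `δ > 0` refutes the target (all printed lower bounds are `≤ 2nw + n`).
* `thesis_false_of_secondColumnGrowth` — the route's own kill criterion `SecondColumnGrowth` (bulk
  growth `(1+c)n² ≤ R̲⟨n,n,2⟩`) refutes the target through C.

No theorem here asserts a Theses decl positively (the positive glue items `CubeNineteenOfDominates`,
`TwoTowerAffine`, `AmortisationOfCruxes` stay with the provers); no definition is introduced.
-/

-- single-conjunct summit: the mandated namespace repeats a component (dupNamespace linter).
set_option linter.dupNamespace false

noncomputable section

namespace Summit.MatrixMultiplication.MatrixMultiplication.Theorems.Thesis.Negative.MarginalColumnsKillSurface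

open Literature.Computability.AlgebraicComplexity
open Summit.MatrixMultiplication.MatrixMultiplication.Theses.MarginalColumns
open Summit.MatrixMultiplication.MatrixMultiplication.Theorems.SecondColumnDominates.Negative

/-- Read-back: the target is literally the conjunction of the two cruxes. -/
theorem thesis_iff : Thesis ↔ SecondColumnDominates ∧ SecondColumnCheap := Iff.rfl

/-- D's tower bound, subtraction-free in `ℕ`, for EVERY `w ≥ 1`:
`T n w + (w−1)·T n 1 ≤ T n 1 + (w−1)·T n 2` (induction on `w`, as in step 1 of the route's `closes`,
which only ever uses it for `w ≤ n`). -/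
theorem tower_le_of_dominates (hD : SecondColumnDominates) {n : ℕ} (hn : 1 ≤ n) :
    ∀ w : ℕ, 1 ≤ w →
      algBorderRank (matMulTensor ℂ n n w) + (w - 1) * algBorderRank (matMulTensor ℂ n n 1)
        ≤ algBorderRank (matMulTensor ℂ n n 1) + (w - 1) * algBorderRank (matMulTensor ℂ n n 2) := by
  intro w hw
  induction w with
  | zero => omega
  | succ w ih =>
    rcases Nat.lt_or_ge w 1 with h0 | h1
    · interval_cases w
      simp
    · have ih' := ih h1
      have hd := hD n w hn h1
      have e1 : w + 1 - 1 = (w - 1) + 1 := by omega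
      rw [e1]
      nlinarith [ih', hd]

/-! ## Finite cells that kill the target -/

/-- **First open cell.** `20 ≤ R̲⟨3,3,3⟩` refutes the target: D at `(n, w) = (3, 2)` reads
`R̲⟨3,3,3⟩ + R̲⟨3,3,1⟩ ≤ R̲⟨3,3,2⟩ + R̲⟨3,3,2⟩ ≤ 14 + 14` (Smirnov 2013, proved in tree) and
`R̲⟨3,3,1⟩ = 9`, i.e. `R̲⟨3,3,3⟩ ≤ 19`. Printed window `17 ≤ R̲⟨3,3,3⟩ ≤ 20`. -/
theorem thesis_false_of_twenty_le_cube (h20 : 20 ≤ algBorderRank (matMulTensor ℂ 3 3 3)) :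
    ¬ Thesis := by
  intro h
  have hd : algBorderRank (matMulTensor ℂ 3 3 3) + algBorderRank (matMulTensor ℂ 3 3 1) ≤
      algBorderRank (matMulTensor ℂ 3 3 2) + algBorderRank (matMulTensor ℂ 3 3 2) :=
    h.1 3 2 (by norm_num) (by norm_num)
  have h14 := Smirnov2013_algBorderRank_matMulTensor_332_le ℂ
  have h9 := algBorderRank_matMulTensor_sq_one 3
  omega

/-- **Sibling tower.** Any `w ≥ 1` with `3w + 2 ≤ R̲⟨2,2,w⟩` refutes the target: D at `n = 2` with
`R̲⟨2,2,1⟩ = 4` and Strassen's `R̲⟨2,2,2⟩ ≤ 7` (both proved in tree) gives `R̲⟨2,2,w⟩ ≤ 3w + 1` for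
every `w`. In print `3w ≤ R̲⟨2,2,w⟩ ≤ 3w + ⌈w/7⌉` (Landsberg–Ryder 2017 §3): undecided from `w = 8` on. -/
theorem thesis_false_of_towerTwoTwo_excess (w : ℕ) (hw : 1 ≤ w)
    (hex : 3 * w + 2 ≤ algBorderRank (matMulTensor ℂ 2 2 w)) : ¬ Thesis := by
  intro h
  have ht := tower_le_of_dominates h.1 (n := 2) (by norm_num) w hw
  have h7 := algBorderRank_matMulTensor_two_le_seven ℂ
  have h4 := algBorderRank_matMulTensor_sq_one 2
  rw [h4] at ht
  have hm : (w - 1) * algBorderRank (matMulTensor ℂ 2 2 2) ≤ (w - 1) * 7 :=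
    Nat.mul_le_mul_left _ h7
  omega

/-- **The `n = 3` tower.** Any `w ≥ 1` with `5w + 5 ≤ R̲⟨3,3,w⟩` refutes the target: D at `n = 3`
with `R̲⟨3,3,1⟩ = 9` and `R̲⟨3,3,2⟩ ≤ 14` gives `R̲⟨3,3,w⟩ ≤ 5w + 4` for every `w` (the Koszul
flattening slope is exactly `5w`; Landsberg–Michałek give `R̲⟨3,3,4⟩ ≥ 21` against `≤ 24` here). -/
theorem thesis_false_of_towerThree_excess (w : ℕ) (hw : 1 ≤ w)
    (hex : 5 * w + 5 ≤ algBorderRank (matMulTensor ℂ 3 3 w)) : ¬ Thesis := by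
  intro h
  have ht := tower_le_of_dominates h.1 (n := 3) (by norm_num) w hw
  have h14 := Smirnov2013_algBorderRank_matMulTensor_332_le ℂ
  have h9 := algBorderRank_matMulTensor_sq_one 3
  rw [h9] at ht
  have hm : (w - 1) * algBorderRank (matMulTensor ℂ 3 3 2) ≤ (w - 1) * 14 :=
    Nat.mul_le_mul_left _ h14
  omega

/-! ## The joint envelope of D ∧ C and the asymptotic kill surface -/

/-- **Envelope.** The target bounds the WHOLE tower: for every `ε > 0` there is `C` with
`R̲⟨n,n,w⟩ ≤ n² + C·(w−1)·n^{1+ε}` for all `n, w ≥ 1` (D's tower bound with `T n 1 = n²`, then C on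
the first marginal). For `w ≤ n` this is (stronger than) the route's `UniformAmortisation`; for
`w > n` it is surplus content of the target that `ω = 2` never needs. -/
theorem envelope_of_thesis (h : Thesis) (ε : ℝ) (hε : 0 < ε) :
    ∃ C : ℝ, ∀ n w : ℕ, 1 ≤ n → 1 ≤ w →
      (algBorderRank (matMulTensor ℂ n n w) : ℝ) ≤
        (n : ℝ) ^ 2 + C * ((w : ℝ) - 1) * (n : ℝ) ^ (1 + ε) := by
  obtain ⟨C, hC⟩ := h.2 ε hε
  refine ⟨C, fun n w hn hw => ?_⟩
  have ht := tower_le_of_dominates h.1 hn w hw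
  rw [algBorderRank_matMulTensor_sq_one] at ht
  have h' : ((algBorderRank (matMulTensor ℂ n n w) + (w - 1) * (n * n) : ℕ) : ℝ)
      ≤ ((n * n + (w - 1) * algBorderRank (matMulTensor ℂ n n 2) : ℕ) : ℝ) := by
    exact_mod_cast ht
  push_cast [Nat.cast_sub hw] at h'
  have h2 := hC n hn
  have hw1 : (0 : ℝ) ≤ (w : ℝ) - 1 := by
    have : (1 : ℝ) ≤ w := by exact_mod_cast hw
    linarith
  have hmul := mul_le_mul_of_nonneg_left h2 hw1
  nlinarith [hmul, h']

/-- **Asymptotic kill surface.** A family of formats `⟨n,n,w⟩` beating the envelope for one fixed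
`δ > 0` and every constant refutes the target. All printed lower bounds (`(2n−1)w` Koszul flattenings,
Landsberg–Ottaviani; `2nw − w + m − …`, Landsberg–Michałek 2018) are `≤ 2nw + n`, far inside. -/
theorem thesis_false_of_superlinear_excess (δ : ℝ) (hδ : 0 < δ)
    (hex : ∀ C : ℝ, ∃ n w : ℕ, 1 ≤ n ∧ 1 ≤ w ∧
      (n : ℝ) ^ 2 + C * ((w : ℝ) - 1) * (n : ℝ) ^ (1 + δ) <
        (algBorderRank (matMulTensor ℂ n n w) : ℝ)) :
    ¬ Thesis := by
  intro h
  obtain ⟨C, hC⟩ := envelope_of_thesis h δ hδ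
  obtain ⟨n, w, hn, hw, hlt⟩ := hex C
  exact absurd (hC n w hn hw) (not_le.2 hlt)

/-- **The route's kill criterion reaches the target.** Bulk growth of the second column
(`SecondColumnGrowth`: `(1+c)n² ≤ R̲⟨n,n,2⟩` for all large `n`, an open all-`n` border-apolarity
target) refutes the target through its C half. -/
theorem thesis_false_of_secondColumnGrowth (hG : SecondColumnGrowth) : ¬ Thesis := fun h =>
  _root_.Summit.MatrixMultiplication.MatrixMultiplication.Theorems.SecondColumnCheap.Negative.secondColumnCheap_false_of_secondColumnGrowth
    hG h.2

end Summit.MatrixMultiplication.MatrixMultiplication.Theorems.Thesis.Negative.MarginalColumnsKillSurface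

end
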